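import Literature.MathematicalPhysics.QuantumManyBody.BoseGasSinePlateau
import Literature.MathematicalPhysics.QuantumManyBody.FreeDirichletGap
import Mathlib.Analysis.Calculus.Deriv.Support
import HarnessLib

/-!
# A near-optimal `C¹` profile for the Dirichlet interval: Rayleigh quotient `≤ (π/L)²(1 + η)`

Topic `Literature/MathematicalPhysics/QuantumManyBody`, namespace `…BoseGas`; integrates the
pointwise bounds of `BoseGasSinePlateau.lean` for the truncated sine `g₀ = sin(π·/L)·p`
(`p` the `C¹` plateau):

* `integral_sin_sq_eq`, `integral_cos_sq_eq` — `∫₀^L sin²(πt/L) = ∫₀^L cos²(πt/L) = L/2`;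
* `exists_truncatedSine` — for `L ≥ 10`: `∫ g₀² ≥ L/2 - 4` and, for every `η > 0`,
  `∫ g₀'² ≤ (1+η)(π/L)²(L/2) + (1+η⁻¹) 8π⁴/L²`;
* `exists_nearOptimal_profile` — **for every `η > 0` and all `L ≥ L₀(η)` there is a `C¹`
  function `g : ℝ → ℝ` with compact support inside `(0, L)`, `∫ g² = 1` and
  `∫ g'² ≤ (π/L)²(1 + η)`** (normalise `g₀`; the ground level `π²/L²` of the Dirichlet interval
  [LSSY2005, Ch. 2 (2.3)] is attained up to `1 + η` inside the `C¹` variational class).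

This is the one-body factor of the product trial state showing `E₀^D(free, N, L) ≤ 3Nπ²(1+η)/L²`.
No definitions.

## References

* [LSSY2005] E. H. Lieb, R. Seiringer, J. P. Solovej, J. Yngvason, *The Mathematics of the Bose
  Gas and its Condensation* (2005), Ch. 2 (2.3).
-/

noncomputable section

namespace Literature.MathematicalPhysics.QuantumManyBody.BoseGas

open _root_.MeasureTheory _root_.Filter _root_.Set _root_.Real intervalIntegral
open scoped Topology

/-! ### The two trigonometric integrals -/

/-- `∫₀^L sin²(πt/L) dt = L/2` (`L > 0`). [folklore] -/
theorem integral_sin_sq_eq {L : ℝ} (hL : 0 < L) : ∫ t in (0 : ℝ)..L, Real.sin (π * t / L) ^ 2 = L / 2 := by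
  have h := integral_two_div_mul_sin_sq hL
  rw [intervalIntegral.integral_const_mul] at h
  field_simp at h
  linarith

/-- `∫₀^L cos²(πt/L) dt = L/2` (`L > 0`). [folklore] -/
theorem integral_cos_sq_eq {L : ℝ} (hL : 0 < L) : ∫ t in (0 : ℝ)..L, Real.cos (π * t / L) ^ 2 = L / 2 := by
  have hs := integral_sin_sq_eq hL
  have hsum : ∫ t in (0 : ℝ)..L, (Real.cos (π * t / L) ^ 2 + Real.sin (π * t / L) ^ 2) = L := by
    have : (fun t : ℝ => Real.cos (π * t / L) ^ 2 + Real.sin (π * t / L) ^ 2) = fun _ => 1 := by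
      funext t; rw [add_comm]; exact Real.sin_sq_add_cos_sq _
    rw [this, intervalIntegral.integral_const]; simp
  rw [intervalIntegral.integral_add ((by fun_prop : Continuous fun t : ℝ =>
      Real.cos (π * t / L) ^ 2).intervalIntegrable _ _)
    ((by fun_prop : Continuous fun t : ℝ => Real.sin (π * t / L) ^ 2).intervalIntegrable _ _)] at hsum
  linarith

/-- `∫_a^b sin²(πt/L) dt ≤ b - a` for `a ≤ b`. [folklore] -/
theorem integral_sin_sq_le {L a b : ℝ} (hab : a ≤ b) :
    ∫ t in a..b, Real.sin (π * t / L) ^ 2 ≤ b - a := by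
  calc ∫ t in a..b, Real.sin (π * t / L) ^ 2 ≤ ∫ t in a..b, (1 : ℝ) :=
        intervalIntegral.integral_mono_on hab ((by fun_prop : Continuous fun t : ℝ =>
          Real.sin (π * t / L) ^ 2).intervalIntegrable _ _) (by simp) fun t _ => Real.sin_sq_le_one _
    _ = b - a := by simp

/-! ### The truncated sine: the two integrals -/

/-- **The truncated sine and its integrals.**  For `L ≥ 10` there is a `C¹` function
`g₀ : ℝ → ℝ` with compact support, vanishing off `(0, L)`, with `∫ g₀² ≥ L/2 - 4` and
`∫ g₀'² ≤ (1+η)(π/L)²(L/2) + (1+η⁻¹)(8π⁴/L²)` for every `η > 0`. [folklore] -/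
theorem exists_truncatedSine {L : ℝ} (hL : 10 ≤ L) :
    ∃ g₀ : ℝ → ℝ, ContDiff ℝ 1 g₀ ∧ HasCompactSupport g₀ ∧ (∀ t, t ∉ Ioo 0 L → g₀ t = 0) ∧
      L / 2 - 4 ≤ ∫ t, g₀ t ^ 2 ∧
      ∀ η : ℝ, 0 < η → ∫ t, deriv g₀ t ^ 2 ≤
        (1 + η) * ((π / L) ^ 2 * (L / 2)) + (1 + η⁻¹) * (8 * π ^ 4 / L ^ 2) := by
  have hL4 : 4 ≤ L := by linarith
  have hL0 : 0 < L := by linarith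
  obtain ⟨p, hp, hp01, hp1, hp2, hpone, hpder, hpnz⟩ := exists_plateau L
  set g₀ : ℝ → ℝ := fun t => Real.sin (π * t / L) * p t with hg₀
  have hg₀c : ContDiff ℝ 1 g₀ := contDiff_sineProfile hp L
  have hg₀s : HasCompactSupport g₀ := hasCompactSupport_sineProfile hp1 hp2
  have hg₀z : ∀ t, t ∉ Ioo 0 L → g₀ t = 0 := fun t ht =>
    sineProfile_eq_zero hp1 hp2 fun h => ht ⟨by linarith [h.1], by linarith [h.2]⟩
  refine ⟨g₀, hg₀c, hg₀s, hg₀z, ?_, fun η hη => ?_⟩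
  · -- the lower bound on `∫ g₀²`
    have hint_g : Integrable fun t => g₀ t ^ 2 := by
      have h : Integrable (fun t => g₀ t * g₀ t) :=
        (hg₀c.continuous.mul hg₀c.continuous).integrable_of_hasCompactSupport hg₀s.mul_right
      simpa [pow_two] using h
    have hint_i : Integrable fun t => (Icc 2 (L - 2)).indicator (fun t => Real.sin (π * t / L) ^ 2) t :=
      ((by fun_prop : Continuous fun t : ℝ => Real.sin (π * t / L) ^ 2).integrableOn_Icc).integrable_indicator
        measurableSet_Icc
    have hmono : ∫ t, (Icc 2 (L - 2)).indicator (fun t => Real.sin (π * t / L) ^ 2) t ≤ ∫ t, g₀ t ^ 2 :=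
      integral_mono hint_i hint_g fun t => indicator_sin_sq_le_sineProfile_sq hpone t
    refine le_trans ?_ hmono
    rw [MeasureTheory.integral_indicator measurableSet_Icc, integral_Icc_eq_integral_Ioc,
      ← intervalIntegral.integral_of_le (by linarith)]
    -- `∫₂^{L-2} sin² = ∫₀^L - ∫₀² - ∫_{L-2}^L ≥ L/2 - 4`
    have hii : ∀ a b : ℝ, IntervalIntegrable (fun t => Real.sin (π * t / L) ^ 2) volume a b := fun a b =>
      (by fun_prop : Continuous fun t : ℝ => Real.sin (π * t / L) ^ 2).intervalIntegrable _ _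
    have h1 := intervalIntegral.integral_add_adjacent_intervals (hii 0 2) (hii 2 (L - 2))
    have h2 := intervalIntegral.integral_add_adjacent_intervals (hii 0 (L - 2)) (hii (L - 2) L)
    have h3 := integral_sin_sq_eq hL0
    have h4 := integral_sin_sq_le (L := L) (show (0 : ℝ) ≤ 2 by norm_num)
    have h5 := integral_sin_sq_le (L := L) (show L - 2 ≤ L by linarith)
    linarith
  · -- the upper bound on `∫ g₀'²`
    have hderc : Continuous (deriv g₀) := hg₀c.continuous_deriv le_rfl
    have hint_d : Integrable fun t => deriv g₀ t ^ 2 := by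
      have h : Integrable (fun t => deriv g₀ t * deriv g₀ t) :=
        (hderc.mul hderc).integrable_of_hasCompactSupport hg₀s.deriv.mul_right
      simpa [pow_two] using h
    set A : ℝ → ℝ := fun t => (Icc 0 L).indicator (fun t => Real.cos (π * t / L) ^ 2) t with hA
    set B : ℝ → ℝ := fun t => (Icc 1 2 ∪ Ioc (L - 2) (L - 1)).indicator (fun _ => 4 * π ^ 4 / L ^ 2) t
      with hB
    have hmeasR : MeasurableSet (Icc (1 : ℝ) 2 ∪ Ioc (L - 2) (L - 1)) :=
      measurableSet_Icc.union measurableSet_Ioc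
    have hint_A : Integrable A :=
      ((by fun_prop : Continuous fun t : ℝ => Real.cos (π * t / L) ^ 2).integrableOn_Icc).integrable_indicator
        measurableSet_Icc
    have hint_B : Integrable B := by
      refine (integrableOn_const ?_).integrable_indicator hmeasR
      exact ((measure_union_le _ _).trans_lt (by simp [Real.volume_Icc, Real.volume_Ioc])).ne
    have hpt : ∀ t, deriv g₀ t ^ 2 ≤ (1 + η) * ((π / L) ^ 2 * A t) + (1 + η⁻¹) * B t := fun t =>
      deriv_sineProfile_sq_le hL4 hp hp01 hp1 hp2 hpder hpnz hη t
    have hmono : ∫ t, deriv g₀ t ^ 2 ≤ ∫ t, ((1 + η) * ((π / L) ^ 2 * A t) + (1 + η⁻¹) * B t) :=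
      integral_mono hint_d (((hint_A.const_mul _).const_mul _).add (hint_B.const_mul _)) hpt
    refine hmono.trans ?_
    rw [integral_add ((hint_A.const_mul _).const_mul _) (hint_B.const_mul _), MeasureTheory.integral_const_mul,
      MeasureTheory.integral_const_mul, MeasureTheory.integral_const_mul]
    -- `∫ A = L/2`
    have hIA : ∫ t, A t = L / 2 := by
      rw [hA, MeasureTheory.integral_indicator measurableSet_Icc, integral_Icc_eq_integral_Ioc,
        ← intervalIntegral.integral_of_le hL0.le, integral_cos_sq_eq hL0]
    -- `∫ B ≤ 8π⁴/L²`
    have hIB : ∫ t, B t ≤ 8 * π ^ 4 / L ^ 2 := by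
      rw [hB, integral_indicator_const _ hmeasR, smul_eq_mul, Measure.real]
      have hvol : (volume (Icc (1 : ℝ) 2 ∪ Ioc (L - 2) (L - 1))).toReal ≤ 2 := by
        have h1 : volume (Icc (1 : ℝ) 2 ∪ Ioc (L - 2) (L - 1)) ≤ ENNReal.ofReal 2 := by
          refine (measure_union_le _ _).trans ?_
          rw [Real.volume_Icc, Real.volume_Ioc, ← ENNReal.ofReal_add (by norm_num) (by linarith)]
          exact ENNReal.ofReal_le_ofReal (by linarith)
        have := ENNReal.toReal_mono ENNReal.ofReal_ne_top h1
        rwa [ENNReal.toReal_ofReal (by norm_num)] at this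
      calc (volume (Icc (1 : ℝ) 2 ∪ Ioc (L - 2) (L - 1))).toReal * (4 * π ^ 4 / L ^ 2)
          ≤ 2 * (4 * π ^ 4 / L ^ 2) := mul_le_mul_of_nonneg_right hvol (by positivity)
        _ = 8 * π ^ 4 / L ^ 2 := by ring
    rw [hIA]
    have : (1 + η⁻¹) * ∫ t, B t ≤ (1 + η⁻¹) * (8 * π ^ 4 / L ^ 2) :=
      mul_le_mul_of_nonneg_left hIB (by positivity)
    linarith

/-! ### Normalisation -/

/-- **A near-optimal `C¹` profile for the Dirichlet interval.**  For every `η > 0` there is `L₀`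
such that for every `L ≥ L₀` some `C¹` function `g : ℝ → ℝ` with compact support, vanishing off
`(0, L)`, has `∫ g² = 1` and `∫ g'² ≤ (π/L)²(1 + η)` (with `g'` continuous). [cite: LSSY2005, Ch. 2 (2.3)] -/
theorem exists_nearOptimal_profile {η : ℝ} (hη : 0 < η) :
    ∃ L₀ : ℝ, 0 < L₀ ∧ ∀ L : ℝ, L₀ ≤ L → ∃ g : ℝ → ℝ, ContDiff ℝ 1 g ∧ HasCompactSupport g ∧
      (∀ t, t ∉ Ioo 0 L → g t = 0) ∧ Continuous (deriv g) ∧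
      (∫ t, g t ^ 2 = 1) ∧ ∫ t, deriv g t ^ 2 ≤ (π / L) ^ 2 * (1 + η) := by
  set η₁ : ℝ := η / 2 with hη₁_def
  have hη₁ : 0 < η₁ := by positivity
  set L₀ : ℝ := 4 * ((1 + η₁⁻¹) * 8 * π ^ 2 + 4 * (1 + η)) / η + 10 with hL₀
  have hL₀pos : 0 < L₀ := by positivity
  refine ⟨L₀, hL₀pos, fun L hL => ?_⟩
  have hnn : 0 ≤ 4 * ((1 + η₁⁻¹) * 8 * π ^ 2 + 4 * (1 + η)) / η := by positivity
  have hL10 : 10 ≤ L := by rw [hL₀] at hL; linarith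
  have hL0 : 0 < L := by linarith
  obtain ⟨g₀, hg₀c, hg₀s, hg₀z, hI, hJ⟩ := exists_truncatedSine hL10
  have hJ₁ := hJ η₁ hη₁
  set I : ℝ := ∫ t, g₀ t ^ 2 with hIdef
  have hI1 : 1 ≤ I := by linarith
  have hI0 : 0 < I := by linarith
  set c : ℝ := (Real.sqrt I)⁻¹ with hc
  have hc0 : 0 < c := by positivity
  have hc2 : c ^ 2 = I⁻¹ := by rw [hc, inv_pow, Real.sq_sqrt hI0.le]
  refine ⟨fun t => c * g₀ t, contDiff_const.mul hg₀c, hg₀s.mul_left, fun t ht => by simp [hg₀z t ht],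
    ?_, ?_, ?_⟩
  · have : deriv (fun t => c * g₀ t) = fun t => c * deriv g₀ t := by
      funext t; exact deriv_const_mul c (hg₀c.differentiable one_ne_zero t)
    rw [this]; exact continuous_const.mul (hg₀c.continuous_deriv le_rfl)
  · have : (fun t => (c * g₀ t) ^ 2) = fun t => c ^ 2 * g₀ t ^ 2 := by funext t; ring
    rw [this, MeasureTheory.integral_const_mul, hc2, inv_mul_cancel₀ hI0.ne']
  · have hder : (fun t => deriv (fun t => c * g₀ t) t ^ 2) = fun t => c ^ 2 * deriv g₀ t ^ 2 := by
      funext t; rw [deriv_const_mul c (hg₀c.differentiable one_ne_zero t)]; ring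
    rw [hder, MeasureTheory.integral_const_mul, hc2]
    -- `J/I ≤ (π/L)²(1+η)` from `J ≤ (π/L)²(1+η)(L/2 - 4)` and `I ≥ L/2 - 4`
    rw [inv_mul_le_iff₀ hI0]
    refine hJ₁.trans ?_
    have hkey : (1 + η₁) * ((π / L) ^ 2 * (L / 2)) + (1 + η₁⁻¹) * (8 * π ^ 4 / L ^ 2) ≤
        (π / L) ^ 2 * (1 + η) * (L / 2 - 4) := by
      -- multiply by `L²/π²`: `(1+η₁)L/2 + (1+η₁⁻¹)8π² ≤ (1+η)(L/2 - 4)`, i.e. `L ≥ L₀ - 10`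
      have hL' : 4 * ((1 + η₁⁻¹) * 8 * π ^ 2 + 4 * (1 + η)) / η ≤ L := by rw [hL₀] at hL; linarith
      rw [div_le_iff₀ hη] at hL'
      have hπ2 : 0 < π ^ 2 := by positivity
      have hsub : (π / L) ^ 2 * (1 + η) * (L / 2 - 4) - ((1 + η₁) * ((π / L) ^ 2 * (L / 2)) +
          (1 + η₁⁻¹) * (8 * π ^ 4 / L ^ 2)) = (π ^ 2 / L ^ 2) * (L * η / 4 - ((1 + η₁⁻¹) * 8 * π ^ 2 +
            4 * (1 + η))) := by
        rw [hη₁_def]; field_simp; ring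
      have hpos : 0 ≤ (π ^ 2 / L ^ 2) * (L * η / 4 - ((1 + η₁⁻¹) * 8 * π ^ 2 + 4 * (1 + η))) :=
        mul_nonneg (by positivity) (by nlinarith)
      linarith
    calc (1 + η₁) * ((π / L) ^ 2 * (L / 2)) + (1 + η₁⁻¹) * (8 * π ^ 4 / L ^ 2)
        ≤ (π / L) ^ 2 * (1 + η) * (L / 2 - 4) := hkey
      _ ≤ (π / L) ^ 2 * (1 + η) * I := mul_le_mul_of_nonneg_left hI (by positivity)
      _ = I * ((π / L) ^ 2 * (1 + η)) := by ring

end Literature.MathematicalPhysics.QuantumManyBody.BoseGas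

end
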